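import Mathlib
import HarnessLib.Audit
import Summits.PneNP.PneNP.Theorems.PstarCrossCaseU2Final

/-!
# The blind free CROSS gate: the product-row toolkit at a LEVEL `c` — rows vanishing on `{u_{e₀} = c}` (O2 / E1; prover-1 g23)

FRONTIER range-avoidance ladder, rung F-N3 (`stmt-PneNP-19007`), cell `pnp-ideate`; restricted-model proof complexity — nothing here bears on `P` versus `NP`.

The N4 toolkit (`PstarCrossCaseU2Touch` / `PstarCrossCaseU2Carrier` / `PstarCrossCaseU2Final`) is stated for quadratics vanishing on `Z(u_{e₀})`.  In
regime T (`PstarCrossCaseTRows.caseT_eq_q10`) and elsewhere the rows vanish on `{u_{e₀} = 1}` instead.  This file restates the toolkit for the level set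
`{u_{e₀} = c}` of an arbitrary `c : 𝔽₂` (`u_{e₀} + c` has the same polar form and rank as `u_{e₀}`); proofs are those of the `c = 0` files verbatim:

* `u_add_const`, `clean_or_nondeg_at`, `factors_fixed_off_D_at`, `untouched_of_not_mem_D_at`, `corner_false_at` (this file);
* `touch_or_carrier_at`, `false_of_third_edge_at`, `untouched_of_row_at`, `untouched_or_carrier_at` (`PstarCrossRowsAtCarrier`).
-/

set_option linter.dupNamespace false -- `Summit.PneNP.PneNP.…`: summit = sub-problem name (D-0017 single-conjunct layout)

open Finset Module Literature.Computability.Complexity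
open Summit.PneNP.PneNP.Theorems.PstarTyped (Typed)
open Summit.PneNP.PneNP.Theorems.PstarSALevel (varSet BoundaryExpanding SimpleOverlap)
open Summit.PneNP.PneNP.Theorems.PstarCentreFree (vars_mem_varSet)
open Summit.PneNP.PneNP.Theorems.PstarCubeIdeals (IsAffineFn IsQuadFn)
open Summit.PneNP.PneNP.Theorems.PstarQuadRank (rad)
open Summit.PneNP.PneNP.Theorems.PstarProductRank (qform polar cover mem_cover IsInducedMatching)
open Summit.PneNP.PneNP.Theorems.PstarPathRank (AndAdj polar_basis and_ne andPair_ne)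
open Summit.PneNP.PneNP.Theorems.PstarReadSumset (V2)
open Summit.PneNP.PneNP.Theorems.PstarRankRigidityTwo (affine_mul_polar symForm linPart symForm_apply linPart_apply)
open Summit.PneNP.PneNP.Theorems.PstarRankRigidityFour (classification)
open Summit.PneNP.PneNP.Theorems.PstarRankRigidity (eq_zero_or_eq_of_rank_six)
open Summit.PneNP.PneNP.Theorems.PstarForcing (exists_ne_of_rank_four not_rank_four_of_mul)
open Summit.PneNP.PneNP.Theorems.PstarCoincidenceMatching (finrank_ker_add_le_of_inducedMatching)
open Summit.PneNP.PneNP.Theorems.PstarChordSystem (ChordSystem)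
open Summit.PneNP.PneNP.Theorems.PstarChordBridgeTools
open Summit.PneNP.PneNP.Theorems.PstarChordBridge
open Summit.PneNP.PneNP.Theorems.PstarChordBridgeForcing (freeMon gam sys_u_eq qform_add' rank_four_of_wf)
open Summit.PneNP.PneNP.Theorems.PstarChordBridgeBasis (qDir polarDir)
open Summit.PneNP.PneNP.Theorems.PstarChordBridgeCorner (qDir_add)
open Summit.PneNP.PneNP.Theorems.PstarCrossData (CrossData)
open Summit.PneNP.PneNP.Theorems.PstarCrossSystem
open Summit.PneNP.PneNP.Theorems.PstarCrossCorner (PrivEdge)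
open Summit.PneNP.PneNP.Theorems.PstarCrossCasePEmptyToggle (andAdj_priv_iff)
open Summit.PneNP.PneNP.Theorems.PstarCrossCaseU2 (u_add)
open Summit.PneNP.PneNP.Theorems.PstarCrossCaseU2Clean (untouched_of_clean)
open Summit.PneNP.PneNP.Theorems.PstarCrossProductRow (untouched_of_product_row)
open Summit.PneNP.PneNP.Theorems.PstarCrossProductAlgebra
open Summit.PneNP.PneNP.Theorems.PstarCrossCaseU2Touch (card_J₀_le u_add_single_of_unread unread_of_not_mem_D ne_of_privEdge carrier_or_corner)
open Summit.PneNP.PneNP.Theorems.PstarCrossCaseU2Carrier (carrier_of_polar)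
open Summit.PneNP.PneNP.Theorems.PstarCrossCaseU2Final (inducedMatching_three)

namespace Summit.PneNP.PneNP.Theorems.PstarCrossRowsAt

variable {n m : ℕ}

section

variable (I : LocalMap 4 n m) {r : ℕ} {B : BridgeData n m} {e_p e_q g₀ : Fin m}

/-! ## Rows vanishing on a level set of `u_{e₀}` -/

/-- `u_{e₀} + c` satisfies the polar identity of `u_{e₀}`. -/
theorem u_add_const (B : BridgeData n m) (e₀ : Fin m) (c : ZMod 2) (x w : Fin n → ZMod 2) :
    (sys I B).u e₀ (x + w) + c = ((sys I B).u e₀ x + c) + ((sys I B).u e₀ w + c) + ((sys I B).u e₀ 0 + c) +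
      polar (B.D e₀) (fun j => I.vars j 2) (fun j => I.vars j 3) x w := by
  rw [u_add I B e₀ x w]
  generalize (sys I B).u e₀ x = a; generalize (sys I B).u e₀ w = b; generalize (sys I B).u e₀ 0 = d
  generalize polar (B.D e₀) (fun j => I.vars j 2) (fun j => I.vars j 3) x w = p
  revert a b d p c; decide

/-- **Rows against the level set `{u_{e₀} = c}` are clean or NON-DEGENERATE products**: a quadratic `g` vanishing where `u_{e₀} = c` is `0`, `u_{e₀} + c`,
or up to adding `u_{e₀} + c` a product of affine functions with both linear parts non-zero and distinct. -/
theorem clean_or_nondeg_at (hI : I.IsPure xorAndPred) (hS : SimpleOverlap I) (hB : BoundaryExpanding r I) (hD : CrossData I r B e_p e_q g₀)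
    {e₀ : Fin m} (he₀ : e₀ ∈ B.N) {c : ZMod 2} {g : (Fin n → ZMod 2) → ZMod 2} (hg : IsQuadFn g) (hZ : ∀ x, (sys I B).u e₀ x = c → g x = 0) :
    ((∀ x, g x = 0) ∨ (∀ x, g x = (sys I B).u e₀ x + c)) ∨
    (∃ μ₁ μ₂ : (Fin n → ZMod 2) → ZMod 2, IsAffineFn μ₁ ∧ IsAffineFn μ₂ ∧
      (∃ z, μ₁ z ≠ μ₁ 0) ∧ (∃ z, μ₂ z ≠ μ₂ 0) ∧ (∃ z, μ₁ z + μ₁ 0 ≠ μ₂ z + μ₂ 0) ∧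
      ((∀ x, g x = μ₁ x * μ₂ x) ∨ (∀ x, (sys I B).u e₀ x + (g x + c) = μ₁ x * μ₂ x))) := by
  have hrank := rank_four_of_wf I hI hS hB hD.wf (card_J₀_le I hD) he₀
  have hu := u_add I B e₀
  have huc := u_add_const I B e₀ c
  have e_iff : ∀ a k : ZMod 2, a + k = 0 ↔ a = k := by decide
  have hZ' : ∀ x, (sys I B).u e₀ x + c = 0 → g x = 0 := fun x hx => hZ x ((e_iff _ _).1 hx)
  have hnc : ∃ v, (sys I B).u e₀ v + c ≠ (sys I B).u e₀ 0 + c := by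
    obtain ⟨v, hv⟩ := exists_ne_of_rank_four hu hrank
    exact ⟨v, fun h => hv (add_right_cancel h)⟩
  rcases classification huc hnc hg hZ' with h | ⟨μ₁, μ₂, hμ₁, hμ₂, hrow⟩ | ⟨a, b, hab, hq, -⟩
  · exact Or.inl h
  · -- product rows: degenerate ones are clean
    have hPZ : ∀ x, (sys I B).u e₀ x + c = 0 → μ₁ x * μ₂ x = 0 := fun x hx => by
      rcases hrow with h | h
      · rw [← h x, hZ' x hx]
      · rw [← h x, hZ' x hx, hx, zero_add]
    by_cases hdeg : (∀ z, μ₁ z = μ₁ 0) ∨ (∀ z, μ₂ z = μ₂ 0) ∨ (∀ z, μ₁ z + μ₁ 0 = μ₂ z + μ₂ 0)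
    · have h0 := mul_eq_zero_of_degenerate (Q := fun x => (sys I B).u e₀ x + c) huc hrank hμ₁ hμ₂ hdeg hPZ
      left
      rcases hrow with h | h
      · exact Or.inl fun x => by rw [h x, h0 x]
      · refine Or.inr fun x => ?_
        have e : ∀ u a : ZMod 2, u + a = 0 → a = u := by decide
        exact e _ _ (by rw [h x, h0 x])
    · push Not at hdeg
      obtain ⟨hn₁, hn₂, hn⟩ := hdeg
      refine Or.inr ⟨μ₁, μ₂, hμ₁, hμ₂, hn₁, hn₂, hn, ?_⟩
      rcases hrow with h | h
      · exact Or.inl h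
      · refine Or.inr fun x => ?_
        rw [← h x]
        have e : ∀ a b k : ZMod 2, a + (b + k) = a + k + b := by decide
        exact e _ _ _
  · -- the NOR row would make `u_{e₀}` a product plus a constant
    exfalso
    set P : LinearMap.BilinForm (ZMod 2) (Fin n → ZMod 2) := polar (B.D e₀) (fun j => I.vars j 2) (fun j => I.vars j 3) with hP
    have hμ : ∀ d : Fin n → ZMod 2, IsAffineFn (fun x => P x d + (((sys I B).u e₀ d + c) + ((sys I B).u e₀ 0 + c))) := by
      intro d x w
      show P (x + w) d + _ = P x d + _ + (P w d + _) + (P 0 d + _)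
      rw [P.map_add, LinearMap.add_apply, P.map_zero, LinearMap.zero_apply]
      have e : ∀ p q k : ZMod 2, p + q + k = p + k + (q + k) + (0 + k) := by decide
      exact e _ _ _
    refine not_rank_four_of_mul hu (hμ b) (hμ a) (κ := c + 1) (fun x => ?_) hrank
    have e : ∀ u p k : ZMod 2, u + k = p + 1 → u = p + (k + 1) := by decide
    exact e _ _ _ (hq x)

/-- **The linear parts of a non-degenerate product vanishing on `{u_{e₀} = c}` live on the AND variables of `D e₀`.** -/
theorem factors_fixed_off_D_at (hI : I.IsPure xorAndPred) (hS : SimpleOverlap I) (hB : BoundaryExpanding r I) (hD : CrossData I r B e_p e_q g₀)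
    {e₀ : Fin m} (he₀ : e₀ ∈ B.N) {μ₁ μ₂ : (Fin n → ZMod 2) → ZMod 2} (h₁ : IsAffineFn μ₁) (h₂ : IsAffineFn μ₂)
    (hn₁ : ∃ z, μ₁ z ≠ μ₁ 0) (hn₂ : ∃ z, μ₂ z ≠ μ₂ 0) (hn : ∃ z, μ₁ z + μ₁ 0 ≠ μ₂ z + μ₂ 0)
    {c : ZMod 2} (hZ : ∀ x, (sys I B).u e₀ x = c → μ₁ x * μ₂ x = 0) {z : Fin n} (hz : ∀ j ∈ B.D e₀, I.vars j 2 ≠ z ∧ I.vars j 3 ≠ z) :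
    μ₁ (Pi.single z 1) = μ₁ 0 ∧ μ₂ (Pi.single z 1) = μ₂ 0 := by
  have e_iff : ∀ a k : ZMod 2, a + k = 0 ↔ a = k := by decide
  exact shift_of_vanish (Q := fun x => (sys I B).u e₀ x + c) (u_add_const I B e₀ c) (rank_four_of_wf I hI hS hB hD.wf (card_J₀_le I hD) he₀)
    h₁ h₂ hn₁ hn₂ hn (fun x hx => hZ x ((e_iff _ _).1 hx)) fun x => by
      show (sys I B).u e₀ (x + Pi.single z 1) + c = _; rw [u_add_single_of_unread I B e₀ hz]

/-- **A non-degenerate row does not read a private tree edge outside `D e₀`.**  Hypotheses on the constraint `(C, G, T)` behind `q_{mv}` as in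
`PstarCrossProductRow.untouched_of_product_row`. -/
theorem untouched_of_not_mem_D_at (hI : I.IsPure xorAndPred) (hS : SimpleOverlap I) (hB : BoundaryExpanding r I) (hD : CrossData I r B e_p e_q g₀)
    {e₀ : Fin m} (he₀ : e₀ ∈ B.N) {mv : V2} {C : Finset (Fin n)} {G T : Finset (Fin m)} (hTJ : T ⊆ B.J₀ \ B.N) (hGJ : Disjoint G B.J₀)
    (hGfree : ∀ g ∈ G, ¬ (I.vars g 2 ∈ privs I B.N ∨ I.vars g 3 ∈ privs I B.N))
    (hlin : ∀ (π : Fin m) (s : Fin 4), π ∈ B.J₀ \ B.N → 2 ≤ s.val → qDir I B mv (Pi.single (I.vars π s) 1) = qDir I B mv 0 → I.vars π s ∉ C)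
    (hpol : ∀ c d : Fin n, polarDir I B mv (Pi.single c 1) (Pi.single d 1) =
      ((polar T (fun j => I.vars j 2) (fun j => I.vars j 3) + polar (freeMon I B.N G) (fun j => I.vars j 2) (fun j => I.vars j 3) :
        LinearMap.BilinForm (ZMod 2) (Fin n → ZMod 2)) (Pi.single c 1)) (Pi.single d 1))
    {κ : ZMod 2} {μ₁ μ₂ : (Fin n → ZMod 2) → ZMod 2} (h₁ : IsAffineFn μ₁) (h₂ : IsAffineFn μ₂)
    (hn₁ : ∃ z, μ₁ z ≠ μ₁ 0) (hn₂ : ∃ z, μ₂ z ≠ μ₂ 0) (hn : ∃ z, μ₁ z + μ₁ 0 ≠ μ₂ z + μ₂ 0)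
    (hrow : (∀ x, qDir I B mv x + κ = μ₁ x * μ₂ x) ∨ (∀ x, (sys I B).u e₀ x + (qDir I B mv x + κ) = μ₁ x * μ₂ x))
    {c : ZMod 2} (hZ : ∀ x, (sys I B).u e₀ x = c → μ₁ x * μ₂ x = 0)
    {π : Fin m} (hπ : PrivEdge I B π) (hπD : π ∉ B.D e₀) :
    (I.vars π 2 ∉ C ∧ I.vars π 3 ∉ C) ∧ ∀ g ∈ G, I.vars g 2 ≠ I.vars π 2 ∧ I.vars g 3 ≠ I.vars π 2 ∧ I.vars g 2 ≠ I.vars π 3 ∧ I.vars g 3 ≠ I.vars π 3 :=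
  untouched_of_product_row I hI hS hD he₀ hTJ hGJ hGfree hlin hpol h₁ h₂ hrow hπ fun _ hs =>
    factors_fixed_off_D_at I hI hS hB hD he₀ h₁ h₂ hn₁ hn₂ hn hZ (unread_of_not_mem_D I hD he₀ hπ hπD hs)
/-- **The corner is impossible** (level `c`): a non-degenerate product vanishing on `{u_{e₀} = c}` cannot be supported on the AND variables of a private
tree edge `π` when `D e₀` has another edge `j₁` (toggle the AND pair of `j₁`). -/
theorem corner_false_at (hI : I.IsPure xorAndPred) (hS : SimpleOverlap I) (hD : CrossData I r B e_p e_q g₀)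
    {e₀ : Fin m} (he₀ : e₀ ∈ B.N) {μ₁ μ₂ : (Fin n → ZMod 2) → ZMod 2} (h₁ : IsAffineFn μ₁) (h₂ : IsAffineFn μ₂)
    (hn₁ : ∃ z, μ₁ z ≠ μ₁ 0) (hn₂ : ∃ z, μ₂ z ≠ μ₂ 0) (hn : ∃ z, μ₁ z + μ₁ 0 ≠ μ₂ z + μ₂ 0)
    {c : ZMod 2} (hZ : ∀ x, (sys I B).u e₀ x = c → μ₁ x * μ₂ x = 0) {π : Fin m} (hπ : PrivEdge I B π) {j₁ : Fin m}
    (hj₁ : j₁ ∈ B.D e₀) (hj₁π : j₁ ≠ π)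
    (hoff : ∀ b, b ≠ I.vars π 2 → b ≠ I.vars π 3 → μ₁ (Pi.single b 1) + μ₁ 0 = 0 ∧ μ₂ (Pi.single b 1) + μ₂ 0 = 0) : False := by
  classical
  obtain ⟨y, hy₁, hy₂⟩ := exists_eq_one_one h₁ h₂ hn₁ hn₂ hn 1 1
  have hvv' : I.vars π 2 ≠ I.vars π 3 := and_ne I hI π
  have hab : I.vars j₁ 2 ≠ I.vars j₁ 3 := and_ne I hI j₁
  have hj₁J : j₁ ∈ B.J₀ := (mem_sdiff.1 (hD.wf.hD e₀ he₀ hj₁)).1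
  have hav : I.vars j₁ 2 ≠ I.vars π 2 := ne_of_privEdge I hπ (Or.inl rfl) hj₁J hj₁π 2
  have hav' : I.vars j₁ 2 ≠ I.vars π 3 := ne_of_privEdge I hπ (Or.inr rfl) hj₁J hj₁π 2
  have hbv : I.vars j₁ 3 ≠ I.vars π 2 := ne_of_privEdge I hπ (Or.inl rfl) hj₁J hj₁π 3
  have hbv' : I.vars j₁ 3 ≠ I.vars π 3 := ne_of_privEdge I hπ (Or.inr rfl) hj₁J hj₁π 3
  -- both factors depend only on the coordinates `v, v'`
  have hW : ∀ μ : (Fin n → ZMod 2) → ZMod 2, (∀ c, c ≠ I.vars π 2 → c ≠ I.vars π 3 → μ (Pi.single c 1) + μ 0 = 0) →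
      ∀ i, i ∉ ({I.vars π 2, I.vars π 3} : Finset (Fin n)) → μ (Pi.single i 1) = μ 0 := by
    intro μ h i hi
    rw [mem_insert, mem_singleton, not_or] at hi
    have e : ∀ a b : ZMod 2, a + b = 0 → a = b := by decide
    exact e _ _ (h i hi.1 hi.2)
  have hW₁ := hW μ₁ fun c hc hc' => (hoff c hc hc').1
  have hW₂ := hW μ₂ fun c hc hc' => (hoff c hc hc').2
  -- the projection of `y` to the coordinates `v, v'`, and the toggle of the AND pair of `j₁`
  set pt : Fin n → ZMod 2 := y (I.vars π 2) • Pi.single (I.vars π 2) 1 + y (I.vars π 3) • Pi.single (I.vars π 3) 1 with hpt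
  set tg : Fin n → ZMod 2 := Pi.single (I.vars j₁ 2) 1 + Pi.single (I.vars j₁ 3) 1 with htg
  have hpt_v : pt (I.vars π 2) = y (I.vars π 2) := by
    simp only [hpt, Pi.add_apply, Pi.smul_apply, smul_eq_mul, Pi.single_eq_same, Pi.single_eq_of_ne hvv', mul_one, mul_zero, add_zero]
  have hpt_v' : pt (I.vars π 3) = y (I.vars π 3) := by
    simp only [hpt, Pi.add_apply, Pi.smul_apply, smul_eq_mul, Pi.single_eq_same, Pi.single_eq_of_ne hvv'.symm, mul_one, mul_zero, zero_add]
  have htg_v : tg (I.vars π 2) = 0 := by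
    simp only [htg, Pi.add_apply, Pi.single_eq_of_ne hav.symm, Pi.single_eq_of_ne hbv.symm, add_zero]
  have htg_v' : tg (I.vars π 3) = 0 := by
    simp only [htg, Pi.add_apply, Pi.single_eq_of_ne hav'.symm, Pi.single_eq_of_ne hbv'.symm, add_zero]
  have hagree : ∀ i ∈ ({I.vars π 2, I.vars π 3} : Finset (Fin n)), pt i = y i := by
    intro i hi
    rw [mem_insert, mem_singleton] at hi
    rcases hi with rfl | rfl
    · exact hpt_v
    · exact hpt_v'
  have hagree' : ∀ i ∈ ({I.vars π 2, I.vars π 3} : Finset (Fin n)), (tg + pt) i = y i := by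
    intro i hi
    rw [Pi.add_apply]
    rw [mem_insert, mem_singleton] at hi
    rcases hi with rfl | rfl
    · rw [htg_v, hpt_v, zero_add]
    · rw [htg_v', hpt_v', zero_add]
  have hP_pt : μ₁ pt * μ₂ pt = 1 := by
    rw [affine_eq_of_agree h₁ hW₁ hagree, affine_eq_of_agree h₂ hW₂ hagree, hy₁, hy₂, mul_one]
  have hP_pt' : μ₁ (tg + pt) * μ₂ (tg + pt) = 1 := by
    rw [affine_eq_of_agree h₁ hW₁ hagree', affine_eq_of_agree h₂ hW₂ hagree', hy₁, hy₂, mul_one]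
  -- `u₀ (tg + pt) = u₀ pt + 1`
  have hu_tg : (sys I B).u e₀ tg = gam B e₀ + 1 := by
    rw [sys_u_eq, htg, qform_add', PstarChordBridgeFlat.qform_single I hI, PstarChordBridgeFlat.qform_single I hI,
      PstarChordBridgeFlat.qform_zero, polar_basis I hI hS, if_pos ⟨j₁, hj₁, Or.inl ⟨rfl, rfl⟩⟩, zero_add, zero_add, zero_add]
  have hu_0 : (sys I B).u e₀ 0 = gam B e₀ := by
    rw [sys_u_eq, PstarChordBridgeFlat.qform_zero, add_zero]
  have hDJ : B.D e₀ ⊆ B.J₀ := (hD.wf.hD e₀ he₀).trans sdiff_subset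
  have hA : ∀ (s s' : Fin 4), (s = 2 ∨ s = 3) → (s' = 2 ∨ s' = 3) → s ≠ s' → ∀ t : Fin 4, I.vars j₁ t ≠ I.vars π s' →
      polar (K := ZMod 2) (B.D e₀) (fun j => I.vars j 2) (fun j => I.vars j 3) (Pi.single (I.vars j₁ t) 1) (Pi.single (I.vars π s) 1) = 0 := by
    intro s s' hs hs' hss' t ht
    rw [polar_basis I hI hS, if_neg]
    intro hAdj
    exact ht ((andAdj_priv_iff I hI hDJ hπ hs hs' hss' _).1 hAdj).2
  have hpol0 : polar (B.D e₀) (fun j => I.vars j 2) (fun j => I.vars j 3) tg pt = 0 := by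
    rw [htg, hpt]
    simp only [map_add, map_smul, LinearMap.add_apply, smul_eq_mul]
    rw [hA 2 3 (Or.inl rfl) (Or.inr rfl) (by decide) 2 hav', hA 2 3 (Or.inl rfl) (Or.inr rfl) (by decide) 3 hbv',
      hA 3 2 (Or.inr rfl) (Or.inl rfl) (by decide) 2 hav, hA 3 2 (Or.inr rfl) (Or.inl rfl) (by decide) 3 hbv]
    simp
  have hu_pt' : (sys I B).u e₀ (tg + pt) = (sys I B).u e₀ pt + 1 := by
    rw [u_add I B e₀, hu_tg, hu_0, hpol0]
    generalize (sys I B).u e₀ pt = a; generalize gam B e₀ = c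
    revert a c; decide
  by_cases hc : (sys I B).u e₀ pt = c
  · have h := hZ pt hc
    rw [hP_pt] at h
    exact one_ne_zero h
  · have hc' : (sys I B).u e₀ pt + 1 = c := by
      have e : ∀ a b : ZMod 2, a ≠ b → a + 1 = b := by decide
      exact e _ _ hc
    have h := hZ (tg + pt) (by rw [hu_pt', hc'])
    rw [hP_pt'] at h
    exact one_ne_zero h

end

end Summit.PneNP.PneNP.Theorems.PstarCrossRowsAt
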